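import Summits.KontsevichZagierPeriods.KontsevichZagierPeriods.Theorems.LinRedNormalFormHoffmanSpanInKZSpanTransfer
import Summits.KontsevichZagierPeriods.KontsevichZagierPeriods.Theorems.MzvKernelInKZ.Negative.WeightsTwoThree

/-!
# Disproof of `LinRedNormalForm.HoffmanSpanInKZ` (stmt-KontsevichZagierPeriods-15044) — findings

Crux (route `LinRedNormalForm`, rank 6): every MZV word generator `[Δ_w, q·∏ ω_ε]` is congruent
modulo `KZ.relations` to a `ℤ`-combination of Hoffman generators `[Δ_w, q'·ω_u]`, `u ∈ {2,3}^×`,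
`|u| = w`, `q' ∈ ℚ`.  Standing disprover's work file (cdisprove seat
`refuter-cdisprove-stmt-KontsevichZagierPeriods-15044-0`).  NOTHING HERE REFUTES THE CRUX.

Findings (all theorems below are sorry-free unless marked NEAR-MISS):

* §0 small models: there is no Hoffman index of weight `1` (`hoffmanGens_one`), so in weight `1`
  the crux says `[Δ₁, q ω_ε] ∈ KZ.relations` — true, because weight-`1` letters are never
  admissible and `q = 0` is forced by integrability (`Negative/Divergence`); in weight `0` it is
  `[pt, q] ≡ [pt, q]`; in weight `4` the only Hoffman index is `(2,2)` (`eq_two_two_of_isHoffman`).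
* §1 LOAD-BEARING HYPOTHESES (any proof must use them):
  `not_withoutDomain` — drop `s.domain = Δ_w`: false, witness `[(1,2), dt/t]` (value `log 2 > 0`,
  but the weight-`1` Hoffman closure is `⊥`, so the conclusion forces a relation, value `0`);
  `not_withoutIntegrand` — drop the word shape of the integrand: false, witness `[Δ₁, 1]`
  (value `1`).
* §2 REFUTED STRENGTHENING `not_sameCoefficient`: one may NOT ask the Hoffman generators to carry
  the same rational coefficient `q` as the word (i.e. integer recombination only): at weight `4`,
  `[Δ₄, ω₀ω₀ω₀ω₁]` has value `ζ(4) = π⁴/90` while every integer combination of `[Δ₄, ω₀ω₁ω₀ω₁]`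
  has value in `ℤ·π⁴/120` (`ζ(4) = (4/3) ζ(2,2)`); the rational rescaling `q ↦ q'` (via
  `KZ.scale`, no division rule) is genuinely used.
* §3 SHAPE OF ANY REFUTATION `not_summit_of_not`: given Brown's theorem
  (`hoffmanSpan_eq_mzvSpace`, Brown 2012 Thm 1.1, a named Literature fact), a refutation of the
  crux refutes the summit `KontsevichZagierPeriods` (Conjecture 1 as formalised): the value of a
  word generator IS a rational Hoffman combination, so `¬ crux` exhibits an element of
  `ker eval ∖ relations`.  Equivalently `crux_of_summit_of_brown`.  Hence the only possible
  disproof is an additive invariant of the four move sets finer than `eval` separating an MZV word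
  from all same-weight Hoffman combinations — a non-motivic obstruction; none is known
  (`Negative/Core.not_of_separating_invariant` is the template).
* §4 THE LINE `Sketch` (lead `prover-line-stmt-KontsevichZagierPeriods-15044-0`): the crux is
  reduced SORRY-FREE to `∀ N, EdsCertificate N` (`spanAt_of_edsCertificate`, landed); the stubs are
  the decidable tables `EdsCertificate 7…10` and the tail `∀ N ≥ 11`.  Attack = exact rank of the
  certificate family (finite double shuffle adm×adm + Hoffman's relation + duality + Hoffman unit
  vectors) per weight: FULL RANK (= `2^{N-2}` admissible words) for every `N ≤ 15` (this seat:
  `N ≤ 12` locally, `N = 12 … 15` by job `j016566`, table in §4; `N = 16` still running at the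
  last edit) — so no stub of the line is false in the computed range and the tables exist; in
  print the family is complete for `N ≤ 20` (Kaneko–Noro–Tsurumaki 2008 verify a sub-family; FDS +
  Hoffman to 16, Minh et al.; EDS + duality to 22/24, Blümlein–Broadhurst–Vermaseren 2010 — all as
  surveyed in Machide 2023, arXiv:2205.13751); the tail beyond is Ihara–Kaneko–Zagier 2006 Conj. 1 /
  the Minh–Jacob–Oussous–Petitot conjecture, OPEN, and a failure at some `N ≥ 21` would break the
  line only (the crux has other relation families).
* §5 LINE FAMILIES: at weight `4` neither Hoffman's relation (`D`) nor finite double shuffle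
  (`F`) can be dropped from `EdsCertificate` (separating functionals `wtH`, `wtF`;
  `no_certificate_four_without_hoffmanRel`, `no_certificate_four_without_fds`), while duality (`K`)
  is dispensable for all `N ≤ 11` (rank experiment).
* LANDED under `Theorems/HoffmanSpanInKZ/Negative/`: `Shape.lean` (p99267, `not_summit_of_not`,
  `exists_index`, `eval_zIdx`), `LoadBearing.lean` (p100296, §0–§2), `Families.lean` (p101711,
  §5) — all three ACCEPTED.  Ideators / planners may import them.  (Tree duplicates noted by
  review: `eq_two_two_of_isHoffman` = `MZV.eq_of_isHoffman_of_weight_eq_four`,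
  `weight_ne_one_of_isHoffman` ⇐ `MZV.two_le_weight_of_isHoffman_cons`.)
* WHY IT RESISTS: value level = Brown's theorem; move level ⊆ the landed calculus half; every
  refutation is summit-strength (§3).  Next regimes: none cheaper than the summit; the seat's
  standing offer to the lead is the rank/certificate generator `compute/eds_rank.py`.
-/

noncomputable section

namespace Summit.KontsevichZagierPeriods.Cruxes.HoffmanSpanInKZ.Disproof

open Set MeasureTheory MvPolynomial
open Literature.NumberTheory.Transcendental
open Summit.KontsevichZagierPeriods.MzvKernelInKZ.Negative
open Summit.KontsevichZagierPeriods.MzvKernelInKZ.TwoPosets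
open Summit.KontsevichZagierPeriods.LinRedNormalForm.HoffmanSpanInKZ (hoffmanGens SpanAt hoffmanSpanInKZ_iff
  zWord_bword_mem_hoffmanGens)
open Summit.KontsevichZagierPeriods.KontsevichZagierPeriods.Theses.LinRedNormalForm (HoffmanSpanInKZ)

/-! ## §0 Small models: the Hoffman generator sets in weights `0`, `1`, `4` -/

/-- No Hoffman index has weight `1` (entries are `2` or `3`). [folklore] -/
theorem weight_ne_one_of_isHoffman {u : List ℕ} (hu : MZV.IsHoffman u) : MZV.weight u ≠ 1 := by
  cases u with
  | nil => simp [MZV.weight]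
  | cons a l =>
    have ha := hu a (by simp)
    simp only [MZV.weight, List.sum_cons]
    omega

/-- The weight-`1` Hoffman generator set of the crux is empty. [folklore] -/
theorem hoffmanGens_one : hoffmanGens 1 = ∅ := by
  ext x
  simp only [hoffmanGens, mem_setOf_eq, mem_empty_iff_false, iff_false, not_exists, not_and]
  intro u q' s' hu hw
  exact absurd hw (weight_ne_one_of_isHoffman hu)

/-- Hence its closure is trivial: in weight `1` the crux asks `[Δ₁, q ω_ε] ∈ KZ.relations`. [folklore] -/
theorem closure_hoffmanGens_one : AddSubgroup.closure (hoffmanGens 1) = ⊥ := by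
  rw [hoffmanGens_one, AddSubgroup.closure_empty]

/-- The only Hoffman index of weight `4` is `(2,2)`. [folklore] -/
theorem eq_two_two_of_isHoffman {u : List ℕ} (hu : MZV.IsHoffman u) (hw : MZV.weight u = 4) :
    u = [2, 2] := by
  match u, hu, hw with
  | [], _, hw => simp [MZV.weight] at hw
  | [a], hu, hw =>
    have ha := hu a (by simp)
    simp [MZV.weight] at hw; omega
  | [a, b], hu, hw =>
    have ha := hu a (by simp)
    have hb := hu b (by simp)
    simp only [MZV.weight, List.sum_cons, List.sum_nil] at hw
    have : a = 2 := by omega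
    have : b = 2 := by omega
    subst_vars; rfl
  | a :: b :: c :: l, hu, hw =>
    have ha := hu a (by simp)
    have hb := hu b (by simp)
    have hc := hu c (by simp)
    simp only [MZV.weight, List.sum_cons] at hw
    omega

/-! ## §1 Load-bearing hypotheses -/

/-- The crux with the DOMAIN hypothesis `s.domain = Δ_w` dropped (integrand still of word shape on
whatever the domain is). Refuted below. -/
def WithoutDomain : Prop :=
  ∀ (w : ℕ) (ε : Fin w → Bool) (q : ℚ) (s : KZ.IntegralRep w),
    EqOn s.integrand (fun t => (q : ℝ) * ∏ i, if ε i then 1 / (1 - t i) else 1 / t i) s.domain →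
    ∃ m ∈ AddSubgroup.closure (hoffmanGens w), KZ.of s - m ∈ KZ.relations

/-- The crux with the INTEGRAND hypothesis dropped (any representation on the simplex).
Refuted below. -/
def WithoutIntegrand : Prop :=
  ∀ (w : ℕ) (s : KZ.IntegralRep w),
    s.domain = {t | (∀ i, 0 < t i) ∧ (∀ i, t i < 1) ∧ StrictAnti t} →
    ∃ m ∈ AddSubgroup.closure (hoffmanGens w), KZ.of s - m ∈ KZ.relations

/-- In weight `1` both variants force `[σ, f] ∈ KZ.relations`, hence value `0` (soundness). -/
theorem value_eq_zero_of_weight_one (s : KZ.IntegralRep 1)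
    (h : ∃ m ∈ AddSubgroup.closure (hoffmanGens 1), KZ.of s - m ∈ KZ.relations) :
    s.value = 0 := by
  obtain ⟨m, hm, hrel⟩ := h
  rw [closure_hoffmanGens_one, AddSubgroup.mem_bot] at hm
  subst hm
  rw [sub_zero] at hrel
  have := (AddMonoidHom.mem_ker).1 (KZ.relations_le_ker_eval_holds hrel)
  rwa [KZ.eval_of] at this

/-- The shifted interval `(1,2) ⊆ ℝ¹`. [folklore] -/
def shiftedInterval : Set (Fin 1 → ℝ) := {t | 1 < t 0 ∧ t 0 < 2}

/-- `(1,2) ⊆ ℝ¹` is `ℚ`-semialgebraic (two strict polynomial inequalities). [folklore] -/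
theorem isSemialgebraic_shiftedInterval :
    Literature.ModelTheory.ExponentialFields.IsSemialgebraic ℚ shiftedInterval := by
  have h : shiftedInterval = {t : Fin 1 → ℝ | 0 < aeval t (X 0 - 1 : MvPolynomial (Fin 1) ℚ)} ∩
      {t | 0 < aeval t (2 - X 0 : MvPolynomial (Fin 1) ℚ)} := by
    ext t; simp [shiftedInterval, sub_pos]
  rw [h]
  exact (Literature.ModelTheory.ExponentialFields.isSemialgebraic_setOf_eval_pos _).inter
    (Literature.ModelTheory.ExponentialFields.isSemialgebraic_setOf_eval_pos _)

/-- `(1,2)` lies in the compact box `[1,2]`. [folklore] -/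
theorem shiftedInterval_subset_Icc :
    shiftedInterval ⊆ Icc (fun _ => (1 : ℝ)) (fun _ => 2) := by
  intro t ht
  refine ⟨fun i => ?_, fun i => ?_⟩ <;> fin_cases i <;> simp [ht.1.le, ht.2.le]

/-- `(1,2) ⊆ ℝ¹` is open. [folklore] -/
theorem isOpen_shiftedInterval : IsOpen shiftedInterval :=
  (isOpen_lt continuous_const (continuous_apply 0)).inter
    (isOpen_lt (continuous_apply 0) continuous_const)

/-- `(1,2)` has positive Lebesgue measure (open, non-empty). [folklore] -/
theorem volume_shiftedInterval_ne_zero : volume shiftedInterval ≠ 0 :=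
  isOpen_shiftedInterval.measure_ne_zero volume ⟨fun _ => 3 / 2, by norm_num [shiftedInterval]⟩

/-- `(1,2)` has finite Lebesgue measure. [folklore] -/
theorem volume_shiftedInterval_ne_top : volume shiftedInterval ≠ ⊤ :=
  (lt_of_le_of_lt (measure_mono shiftedInterval_subset_Icc)
    (isCompact_Icc.measure_lt_top)).ne

/-- The witness `[(1,2), dt/t]` against `WithoutDomain`: a weight-`1` word integrand (`ε = 0`,
`q = 1`) on the wrong domain. [folklore] -/
def logTwoRep : KZ.IntegralRep 1 where
  domain := shiftedInterval
  integrand t := 1 / t 0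
  isSemialgebraic_domain := isSemialgebraic_shiftedInterval
  isSemialgebraicFunOn_integrand := by
    refine (isSemialgebraicFunOn_aeval_div_aeval isSemialgebraic_shiftedInterval
      (1 : MvPolynomial (Fin 1) ℚ) (X 0) fun t ht => ?_).congr fun t _ => by simp
    simpa using (zero_lt_one.trans ht.1).ne'
  integrableOn := by
    have hc : ContinuousOn (fun t : Fin 1 → ℝ => 1 / t 0) (Icc (fun _ => (1 : ℝ)) (fun _ => 2)) := by
      refine ContinuousOn.div continuousOn_const (continuous_apply 0).continuousOn fun t ht => ?_
      exact (zero_lt_one.trans_le (ht.1 0)).ne'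
    exact (hc.integrableOn_compact isCompact_Icc).mono_set shiftedInterval_subset_Icc

/-- Its value is positive (`≥ ½ · vol (1,2) > 0`; in fact `log 2`). [folklore] -/
theorem logTwoRep_value_pos : 0 < logTwoRep.value := by
  have h1 : (1 / 2 : ℝ) * volume.real shiftedInterval ≤ logTwoRep.value := by
    refine setIntegral_ge_of_const_le_real isOpen_shiftedInterval.measurableSet
      volume_shiftedInterval_ne_top (fun t ht => ?_) logTwoRep.integrableOn
    show (1 / 2 : ℝ) ≤ 1 / t 0
    exact one_div_le_one_div_of_le (zero_lt_one.trans ht.1) ht.2.le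
  have h2 : 0 < volume.real shiftedInterval :=
    ENNReal.toReal_pos volume_shiftedInterval_ne_zero volume_shiftedInterval_ne_top
  linarith

/-- **Load-bearing: the domain hypothesis cannot be dropped.** Witness `[(1,2), dt/t]`
(`w = 1`, `ε = 0`, `q = 1`): the weight-`1` Hoffman closure is `⊥`, so `WithoutDomain` forces
`[(1,2), dt/t] ∈ KZ.relations`, value `0`, against `value = log 2 > 0`. [folklore] -/
theorem not_withoutDomain : ¬ WithoutDomain := by
  intro h
  have h0 := value_eq_zero_of_weight_one logTwoRep
    (h 1 (fun _ => false) 1 logTwoRep fun t _ => by simp [logTwoRep])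
  exact logTwoRep_value_pos.ne' h0

/-- `StrictAnti` is automatic in dimension `1`. [folklore] -/
theorem strictAnti_fin_one (t : Fin 1 → ℝ) : StrictAnti t := fun a b hab =>
  absurd hab (by rw [Subsingleton.elim a b]; exact lt_irrefl _)

/-- The weight-`1` simplex is the open unit interval `(0,1) ⊆ ℝ¹`. [folklore] -/
theorem simplex_one_eq : simplex 1 = {t : Fin 1 → ℝ | 0 < t 0 ∧ t 0 < 1} := by
  ext t
  simp only [simplex, mem_setOf_eq, Fin.forall_fin_one, strictAnti_fin_one t, and_true]

/-- The weight-`1` simplex is open. [folklore] -/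
theorem isOpen_simplex_one : IsOpen (simplex 1) := by
  rw [simplex_one_eq]
  exact (isOpen_lt continuous_const (continuous_apply 0)).inter
    (isOpen_lt (continuous_apply 0) continuous_const)

/-- The weight-`1` simplex lies in the compact box `[0,1]`. [folklore] -/
theorem simplex_one_subset_Icc : simplex 1 ⊆ Icc (fun _ => (0 : ℝ)) (fun _ => 1) := by
  intro t ht
  rw [simplex_one_eq] at ht
  refine ⟨fun i => ?_, fun i => ?_⟩ <;> fin_cases i <;> simp [ht.1.le, ht.2.le]

/-- The weight-`1` simplex has positive Lebesgue measure. [folklore] -/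
theorem volume_simplex_one_ne_zero : volume (simplex 1) ≠ 0 :=
  isOpen_simplex_one.measure_ne_zero volume
    ⟨fun _ => 1 / 2, by rw [simplex_one_eq]; norm_num⟩

/-- The weight-`1` simplex has finite Lebesgue measure. [folklore] -/
theorem volume_simplex_one_ne_top : volume (simplex 1) ≠ ⊤ :=
  (lt_of_le_of_lt (measure_mono simplex_one_subset_Icc) (isCompact_Icc.measure_lt_top)).ne

/-- The witness `[Δ₁, 1]` against `WithoutIntegrand`: the constant `1` on the weight-`1` simplex
`(0,1)`. [folklore] -/
def unitRep : KZ.IntegralRep 1 where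
  domain := simplex 1
  integrand _ := 1
  isSemialgebraic_domain := KZ.isSemialgebraic_openOrderedSimplex 1
  isSemialgebraicFunOn_integrand :=
    (isSemialgebraicFunOn_aeval (KZ.isSemialgebraic_openOrderedSimplex 1) 1).congr
      fun t _ => by simp
  integrableOn := by
    refine (integrableOn_const_iff).mpr (Or.inr ?_)
    exact lt_top_iff_ne_top.mpr volume_simplex_one_ne_top

/-- Its value is `vol Δ₁ > 0` (`= 1`). [folklore] -/
theorem unitRep_value_pos : 0 < unitRep.value := by
  show 0 < ∫ _ in simplex 1, (1 : ℝ)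
  rw [setIntegral_const, smul_eq_mul, mul_one]
  exact ENNReal.toReal_pos volume_simplex_one_ne_zero volume_simplex_one_ne_top

/-- **Load-bearing: the word shape of the integrand cannot be dropped.** Witness `[Δ₁, 1]`:
`WithoutIntegrand` forces it into `KZ.relations` (weight-`1` Hoffman closure `= ⊥`), value `0`,
against value `1`. [folklore] -/
theorem not_withoutIntegrand : ¬ WithoutIntegrand := by
  intro h
  exact unitRep_value_pos.ne' (value_eq_zero_of_weight_one unitRep (h 1 unitRep rfl))



/-! ## §2 A refuted strengthening: integer recombination with the SAME coefficient -/

/-- STRENGTHENING (refuted below): the Hoffman generators must carry the same rational coefficient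
`q` as the given word generator, i.e. only integer recombination is allowed. -/
def SameCoefficient : Prop :=
  ∀ (w : ℕ) (ε : Fin w → Bool) (q : ℚ) (s : KZ.IntegralRep w),
    s.domain = {t | (∀ i, 0 < t i) ∧ (∀ i, t i < 1) ∧ StrictAnti t} →
    EqOn s.integrand (fun t => (q : ℝ) * ∏ i, if ε i then 1 / (1 - t i) else 1 / t i) s.domain →
    ∃ m ∈ AddSubgroup.closure {x : KZ.FormalRep | ∃ (u : List ℕ)
        (s' : KZ.IntegralRep (MZV.weight u)), MZV.IsHoffman u ∧ MZV.weight u = w ∧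
        s'.domain = {t | (∀ i, 0 < t i) ∧ (∀ i, t i < 1) ∧ StrictAnti t} ∧
        EqOn s'.integrand (fun t => (q : ℝ) * KZ.mzvIntegrand u t) s'.domain ∧ x = KZ.of s'},
      KZ.of s - m ∈ KZ.relations

/-- The letters of the index `(2,2)` are `ω₀ω₁ω₀ω₁`. [folklore] -/
theorem binaryWord_two_two : ∀ i : Fin 4, (MZV.binaryWord [2, 2]).getD i false = ω22 i := by
  decide

/-- Every weight-`4` Hoffman generator with coefficient `1` has value `ζ(2,2) = π⁴/120`
(`Negative.value_ω22`, off-domain freedom, soundness). [folklore] -/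
theorem value_of_isHoffman_four {u : List ℕ} (hu : MZV.IsHoffman u) (hw : MZV.weight u = 4)
    (s' : KZ.IntegralRep (MZV.weight u))
    (hd : s'.domain = {t | (∀ i, 0 < t i) ∧ (∀ i, t i < 1) ∧ StrictAnti t})
    (hi : EqOn s'.integrand (fun t => ((1 : ℚ) : ℝ) * KZ.mzvIntegrand u t) s'.domain) :
    s'.value = Real.pi ^ 4 / 120 := by
  obtain rfl := eq_two_two_of_isHoffman hu hw
  have hr : KZ.of s' - KZ.of (wordRep (w := MZV.weight [2, 2]) ω22 1 adm_ω22) ∈ KZ.relations := by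
    refine of_sub_of_wordRep_mem_relations (w := MZV.weight [2, 2]) adm_ω22 s' hd fun t ht => ?_
    rw [hi ht]
    simp only [KZ.mzvIntegrand, KZ.mzvForm]
    congr 1
  have := (AddMonoidHom.mem_ker).1 (KZ.relations_le_ker_eval_holds hr)
  rw [map_sub, sub_eq_zero, KZ.eval_of, KZ.eval_of] at this
  rw [this]
  exact value_ω22

/-- **Refuted strengthening.** `SameCoefficient` fails at weight `4`: `[Δ₄, ω₀ω₀ω₀ω₁]` has value
`ζ(4) = π⁴/90` (`Negative.value_ω4`), every element of the closure of the coefficient-`1` Hoffman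
generators of weight `4` has value in `ℤ · π⁴/120`, and `π⁴/90 = n · π⁴/120` forces `3n = 4`.
So the crux genuinely needs the free rational coefficient `q'` (realised by `KZ.scale`, not by a
division rule): `ζ(4) = (4/3) ζ(2,2)`. [folklore] -/
theorem not_sameCoefficient : ¬ SameCoefficient := by
  intro h
  obtain ⟨m, hm, hrel⟩ := h 4 ω4 1 (wordRep ω4 1 adm_ω4) rfl (fun t _ => rfl)
  have hval : ∃ n : ℤ, KZ.eval m = n * (Real.pi ^ 4 / 120) := by
    clear hrel
    induction hm using AddSubgroup.closure_induction with
    | mem x hx =>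
      obtain ⟨u, s', hu, hw, hd, hi, rfl⟩ := hx
      exact ⟨1, by rw [KZ.eval_of, value_of_isHoffman_four hu hw s' hd hi]; simp⟩
    | zero => exact ⟨0, by simp⟩
    | add x y _ _ hx hy =>
      obtain ⟨a, ha⟩ := hx
      obtain ⟨b, hb⟩ := hy
      exact ⟨a + b, by rw [map_add, ha, hb]; push_cast; ring⟩
    | neg x _ hx =>
      obtain ⟨a, ha⟩ := hx
      exact ⟨-a, by rw [map_neg, ha]; push_cast; ring⟩
  obtain ⟨n, hn⟩ := hval
  have h0 := (AddMonoidHom.mem_ker).1 (KZ.relations_le_ker_eval_holds hrel)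
  rw [map_sub, sub_eq_zero, KZ.eval_of, value_ω4, hn] at h0
  have h3 : (4 : ℝ) * Real.pi ^ 4 = 3 * n * Real.pi ^ 4 := by linarith [h0]
  have hne : Real.pi ^ 4 ≠ 0 := by positivity
  have h4 : (4 : ℝ) = 3 * n := mul_right_cancel₀ hne h3
  have h5 : (4 : ℤ) = 3 * n := by exact_mod_cast h4
  omega

/-! ## §3 Shape of any refutation: the crux follows from the summit and Brown's theorem -/

/-- Every word with admissible letters is the word of an admissible index of the same weight
(`TwoPosets.exists_index_of_adm`, plus the empty word). [folklore] -/
theorem exists_index {w : ℕ} (ε : Fin w → Bool) (hε : Adm ε) :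
    ∃ s : List ℕ, MZV.IsAdmissible s ∧ MZV.weight s = w ∧ bword w s = ε := by
  rcases Nat.eq_zero_or_pos w with rfl | hw
  · exact ⟨[], MZV.isAdmissible_nil, rfl, funext fun i => i.elim0⟩
  · obtain ⟨s, hs, hsw, hbw⟩ := exists_index_of_adm hw ε hε
    refine ⟨s, hs, hsw, funext fun i => ?_⟩
    simp [bword, wordOf, hbw, List.getD_eq_getElem?_getD, i.isLt]

/-- The value of the bracket of an admissible index: `eval [ζ(u)]_r = r · ζ(u)`. [folklore] -/
theorem eval_zIdx {u : List ℕ} (hu : MZV.IsAdmissible u) (r : ℚ) :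
    KZ.eval (zIdx u r) = r * multipleZeta u := by
  rw [zIdx_of_adm hu, KZ.eval_of, value_wordRep,
    value_wordRep_eq_multipleZeta u hu _ (adm_bword hu) fun _ => rfl]

/-- **The crux follows from the summit and Brown's theorem.** Given Hoffman spanning at the value
level (`hoffmanSpan_eq_mzvSpace`, Brown 2012, Thm 1.1 — a named Literature fact, not proved in the
tree) and Conjecture 1 as formalised (`KontsevichZagierPeriods`, in its kernel form
`Negative.withoutClosure_iff_summit`), every word generator is congruent to a rational Hoffman
combination: the difference evaluates to `0`. [cite: Brown2012, Theorem 1.1] -/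
theorem crux_of_summit_of_brown (hB : hoffmanSpan_eq_mzvSpace)
    (hS : _root_.KontsevichZagierPeriods) : HoffmanSpanInKZ := by
  have hK : WithoutClosure := withoutClosure_iff_summit.mpr hS
  intro w ε q s hdom hint
  by_cases hε : Adm ε
  swap
  · exact ⟨0, zero_mem _, by simpa using of_mem_relations_of_not_adm s hdom hint hε⟩
  obtain ⟨sidx, hadm, hsw, hbw⟩ := exists_index ε hε
  have hmem : multipleZeta sidx ∈ hoffmanSpan w := by
    rw [hB w]
    exact Submodule.subset_span ⟨sidx, hadm, hsw, rfl⟩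
  obtain ⟨n, f, g, hsum⟩ := Submodule.mem_span_set'.mp hmem
  have hg : ∀ i, ∃ u, MZV.IsHoffman u ∧ MZV.weight u = w ∧ (g i : ℝ) = multipleZeta u :=
    fun i => (g i).2
  choose u hu hwu hgu using hg
  refine ⟨∑ i, zIdx (u i) (q * f i), sum_mem fun i _ => AddSubgroup.subset_closure ?_, ?_⟩
  · rw [← zWord_bword_eq_zIdx (hwu i)]
    exact zWord_bword_mem_hoffmanGens (hu i) (hwu i) _
  · apply hK
    rw [map_sub, map_sum, sub_eq_zero]
    have h1 : KZ.eval (KZ.of s) = q * multipleZeta sidx := by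
      have hr := of_sub_of_wordRep_mem_relations hε s hdom hint
      have h2 := (AddMonoidHom.mem_ker).1 (KZ.relations_le_ker_eval_holds hr)
      rw [map_sub, sub_eq_zero] at h2
      rw [h2, ← zWord_of_adm hε, ← hbw, zWord_bword_eq_zIdx hsw, eval_zIdx hadm]
    rw [h1]
    simp_rw [eval_zIdx (hu _).isAdmissible, ← hgu]
    rw [← hsum, Finset.mul_sum]
    refine Finset.sum_congr rfl fun i _ => ?_
    rw [Rat.smul_def]
    push_cast
    ring

/-- **Shape of any refutation.** Given Brown's theorem, a refutation of the crux is a refutation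
of the summit (Conjecture 1 as formalised): it must exhibit an element of `ker eval ∖ relations`,
i.e. an additive invariant of the four move sets finer than the value
(`Negative.not_of_separating_invariant`). [cite: Brown2012, Theorem 1.1] -/
theorem not_summit_of_not (hB : hoffmanSpan_eq_mzvSpace) (h : ¬ HoffmanSpanInKZ) :
    ¬ _root_.KontsevichZagierPeriods :=
  fun hS => h (crux_of_summit_of_brown hB hS)

/-! ## §4 Line `Sketch` — targets

`HoffmanSpanInKZ_of` (Cruxes/HoffmanSpanInKZ/Lines/Sketch.lean) composes the crux BY NAME from
`stub_spanTransfer` (LANDED: `Theorems/LinRedNormalFormHoffmanSpanInKZSpanTransfer.lean`,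
`spanAt_of_edsCertificate`), the tables `stub_eds7 … stub_eds10 : EdsCertificate 7…10` and the tail
`stub_edsTail : ∀ N ≥ 11, EdsCertificate N`.  Joint sufficiency is syntactic (rc 0); nothing is
smuggled: `EdsCertificate N ↔ rank_ℚ (family N) = 2^{N-2}` where family N = FDS vectors of pairs of
non-empty admissible indices + Hoffman's relation vectors (Hoffman 1992 Thm 5.1) + duality vectors
+ Hoffman unit vectors, all supported on admissible words.

ATTACK (exact modular rank of THIS family, the tree's vectors verbatim — `binaryWord`, `shuffleWord`,
`stuffle`, `hoffmanVec`, `dualWord` re-implemented; script `compute/eds_rank.py` in the seat folder,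
job `j016566` attached to the item as evidence):

| `N` | adm. words | duality orbits | rank(H units + Hoffman rel.) | FDS pairs used / all | full |
|---|---|---|---|---|---|
| 7 | 32 | 16 | — | 9 / 32 | yes |
| 8 | 64 | 36 | — | 17 / 80 | yes |
| 9 | 128 | 64 | — | 34 / 192 | yes |
| 10 | 256 | 136 | — | 71 / 448 | yes |
| 11 | 512 | 256 | — | 135 / 1024 | yes |
| 12 | 1024 | 528 | 268 | 280 / 2304 | yes |
| 13 | 2048 | 1024 | 512 | 537 / 5120 | yes |
| 14 | 4096 | 2080 | 1045 | 1082 / 11264 | yes |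
| 15 | 8192 | 4096 | 2044 | 2158 / 24576 | yes |

(`N = 16`: 8256 orbits, running at the last edit — see NOTES / job log; rank mod `2³¹ − 1`, and
rank mod p ≤ rank over `ℚ`, so FULL is a proof of existence of the certificates.)  Hence NO STUB OF
THE LINE IS FALSE for `N ≤ 15`: the tables `EdsCertificate 7…15` exist (a finite search for the lead's `edsCertificate_of_table₂`
checker).  LITERATURE (survey in Machide, Tsukuba J. Math. 47 (2023), arXiv:2205.13751, §1 and §3):
FDS + Hoffman's relation (the Minh–Jacob–Petitot–Oussous conjecture) verified complete to weight 16
[MJPO00]; Kaneko–Noro–Tsurumaki 2008 verified a SMALLER sub-family (FDS with one factor in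
`{(2)}, {(3),(2,1)}` + Hoffman's relations) complete to weight 20, hence our family is complete for
all `N ≤ 20`; EDS + duality to weight 22 (24 modular) [Blümlein–Broadhurst–Vermaseren 2010].  So
`stub_edsTail` is numerically true for `11 ≤ N ≤ 20` and OPEN beyond (Ihara–Kaneko–Zagier 2006
Conj. 1 / MJPO); a rank DEFICIT at some `N ≥ 21` would give a decidable
`theorem stub_edsTail_false : ¬ ∀ N, 11 ≤ N → EdsCertificate N` (explicit separating functional),
breaking the line only — the crux keeps the associator / confluence / Kawashima families.

Side remark for the lead (from the rank profile): Hoffman's relations + duality give almost exactly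
HALF the rank in every weight (`268/528`, `512/1024`, `1045/2080`, `2044/4096`), and random FDS pairs are
independent until full rank (pairs used ≈ deficit + 2 %), so a certificate table needs only
≈ `2^{N-3}` FDS pairs; the mod-2 / mod-3 deficits of Ideator2Computations §2 are invisible over `ℚ`.
-/

/-! ## §5 Line `Sketch`: which relation families of `EdsCertificate` are load-bearing

Rank experiments (this seat, `compute/eds_rank.py` with `JOB_NO_DUAL / JOB_NO_HOF / JOB_NO_FDS`):
WITHOUT DUALITY the family FDS + Hoffman's relation + Hoffman units still has full rank for every
`3 ≤ N ≤ 11` (so the `K` lists are dispensable there — the Minh–Jacob–Oussous–Petitot family);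
WITHOUT HOFFMAN'S RELATION (FDS + duality + units) the rank is deficient at `N = 4, 6, 7, 9, 10`
(ranks `2/3, 9/10, 15/16, 62/64, 135/136` of the duality-orbit counts; full at `N = 5, 8`);
WITHOUT FDS it is deficient from `N = 4` on.  The two weight-`4` deficiencies are THEOREMS below
(explicit separating functionals, kernel-checked arithmetic): `no_certificate_four_without_hoffmanRel`,
`no_certificate_four_without_fds`. -/

/-! ## Linear functionals on coefficient vectors, evaluated on formal combinations -/

/-- The `ℚ`-linear functional on coefficient vectors of length-`N` words given by a weight on each
word: `v ↦ ∑_ε wt(ε) · v(ε)`. [folklore] -/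
def func {N : ℕ} (wt : (Fin N → Bool) → ℚ) : Vec N →ₗ[ℚ] ℚ :=
  ∑ ε : Fin N → Bool, wt ε • LinearMap.proj ε

/-- `func wt v = ∑_ε wt ε · v ε`. [folklore] -/
theorem func_apply {N : ℕ} (wt : (Fin N → Bool) → ℚ) (v : Vec N) :
    func wt v = ∑ ε, wt ε * v ε := by
  simp [func, LinearMap.sum_apply]

/-- `func wt` on a unit vector is the weight of the word. [folklore] -/
theorem func_unitVec {N : ℕ} (wt : (Fin N → Bool) → ℚ) (ε : Fin N → Bool) :
    func wt (unitVec N ε) = wt ε := by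
  classical
  rw [func_apply, unitVec, Finset.sum_eq_single ε]
  · simp
  · intro ε' _ hne
    simp [Pi.single_eq_of_ne hne]
  · intro h; exact absurd (Finset.mem_univ ε) h

/-- `func wt` on the realisation of a formal combination is computed letter by letter (the form in
which `decide` evaluates it). [folklore] -/
theorem func_eval {N : ℕ} (wt : (Fin N → Bool) → ℚ) (v : FVec) :
    func wt (FVec.eval N v) = (v.map fun p => p.2 * wt (wordOf N p.1)).sum := by
  induction v with
  | nil => simp
  | cons p v ih =>
    rw [FVec.eval_cons, map_add, map_smul, ih, func_unitVec, List.map_cons, List.sum_cons,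
      smul_eq_mul]

/-- `func wt` on a finite double shuffle vector, as a list computation. [folklore] -/
theorem func_fdsVec {N : ℕ} (wt : (Fin N → Bool) → ℚ) (s t : List ℕ) :
    func wt (fdsVec N s t) = ((fdsF s t).map fun p => p.2 * wt (wordOf N p.1)).sum := by
  rw [← eval_fdsF, func_eval]

/-- `func wt` on a Hoffman relation vector, as a list computation. [folklore] -/
theorem func_hoffmanVec {N : ℕ} (wt : (Fin N → Bool) → ℚ) (s : List ℕ) :
    func wt (hoffmanVec N s) = ((hoffmanF s).map fun p => p.2 * wt (wordOf N p.1)).sum := by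
  rw [← eval_hoffmanF, func_eval]

/-- `func wt` kills a duality vector when the weight is duality-invariant at that word. [folklore] -/
theorem func_dualVec {N : ℕ} (wt : (Fin N → Bool) → ℚ) (ε : Fin N → Bool)
    (h : wt ε = wt (dualWord ε)) : func wt (dualVec N ε) = 0 := by
  rw [dualVec, map_sub, func_unitVec, func_unitVec, h, sub_self]

/-- A list of scaled vectors all killed by a functional sums to `0` under it. [folklore] -/
theorem func_sum_eq_zero {N : ℕ} {α : Type*} (wt : (Fin N → Bool) → ℚ) (l : List α)
    (c : α → ℚ) (v : α → Vec N) (h : ∀ a ∈ l, func wt (v a) = 0) :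
    func wt (l.map fun a => c a • v a).sum = 0 := by
  rw [map_list_sum, List.map_map]
  apply List.sum_eq_zero
  intro x hx
  obtain ⟨a, ha, rfl⟩ := List.mem_map.1 hx
  simp [h a ha]

/-! ## Small enumerations of indices -/

/-- A list of positive integers with sum `0` is empty. [folklore] -/
theorem eq_nil_of_sum_eq_zero {l : List ℕ} (h1 : ∀ i ∈ l, 1 ≤ i) (h : l.sum = 0) : l = [] := by
  cases l with
  | nil => rfl
  | cons b l =>
    have hb := h1 b (by simp)
    simp only [List.sum_cons] at h
    omega

/-- A list of positive integers with sum `1` is `[1]`. [folklore] -/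
theorem eq_singleton_of_sum_eq_one {l : List ℕ} (h1 : ∀ i ∈ l, 1 ≤ i) (h : l.sum = 1) :
    l = [1] := by
  cases l with
  | nil => simp at h
  | cons b l =>
    have hb := h1 b (by simp)
    simp only [List.sum_cons] at h
    have hl : l = [] := eq_nil_of_sum_eq_zero (fun i hi => h1 i (by simp [hi])) (by omega)
    subst hl
    simp only [List.sum_nil] at h
    have : b = 1 := by omega
    subst this; rfl

/-- A non-empty admissible index has weight `≥ 2`. [folklore] -/
theorem two_le_weight {s : List ℕ} (hs : MZV.IsAdmissible s) (hne : s ≠ []) :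
    2 ≤ MZV.weight s := by
  obtain ⟨a, l, rfl⟩ := List.exists_cons_of_ne_nil hne
  have := hs.2 (List.cons_ne_nil a l)
  simp only [List.head_cons] at this
  simp only [MZV.weight, List.sum_cons]; omega

/-- The only non-empty admissible index of weight `2` is `(2)`. [folklore] -/
theorem eq_two_of_isAdmissible {s : List ℕ} (hs : MZV.IsAdmissible s) (hne : s ≠ [])
    (hw : MZV.weight s = 2) : s = [2] := by
  obtain ⟨a, l, rfl⟩ := List.exists_cons_of_ne_nil hne
  have ha : 2 ≤ a := hs.2 (List.cons_ne_nil a l)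
  simp only [MZV.weight, List.sum_cons] at hw
  have hl : l = [] := eq_nil_of_sum_eq_zero (fun i hi => hs.1 i (by simp [hi])) (by omega)
  subst hl
  simp only [List.sum_nil] at hw
  have : a = 2 := by omega
  subst this; rfl

/-- The admissible indices of weight `3` are `(3)` and `(2,1)`. [folklore] -/
theorem eq_of_isAdmissible_weight_three {s : List ℕ} (hs : MZV.IsAdmissible s)
    (hw : MZV.weight s = 3) : s = [3] ∨ s = [2, 1] := by
  have hne : s ≠ [] := by rintro rfl; simp [MZV.weight] at hw
  obtain ⟨a, l, rfl⟩ := List.exists_cons_of_ne_nil hne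
  have ha : 2 ≤ a := hs.2 (List.cons_ne_nil a l)
  have hl1 : ∀ i ∈ l, 1 ≤ i := fun i hi => hs.1 i (by simp [hi])
  simp only [MZV.weight, List.sum_cons] at hw
  rcases Nat.lt_or_ge a 3 with h | h
  · have ha2 : a = 2 := by omega
    subst ha2
    right
    rw [eq_singleton_of_sum_eq_one hl1 (by omega)]
  · have ha3 : a = 3 := by omega
    subst ha3
    left
    rw [eq_nil_of_sum_eq_zero hl1 (by omega)]

/-! ## Weight 4: Hoffman's relation is load-bearing, finite double shuffle is load-bearing -/

/-- Separating weights against FDS + duality + Hoffman units at weight `4`: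
`0001, 0111 ↦ 4`, `0011 ↦ 1`, everything else (in particular the Hoffman word `0101`) `↦ 0`.
[folklore] -/
def wtH (ε : Fin 4 → Bool) : ℚ :=
  if ε = ![false, false, false, true] then 4 else
  if ε = ![false, false, true, true] then 1 else
  if ε = ![false, true, true, true] then 4 else 0

/-- Separating weights against Hoffman's relation + duality + Hoffman units at weight `4`: the
indicator of `ε ≠ 0101`. [folklore] -/
def wtF (ε : Fin 4 → Bool) : ℚ :=
  if ε = ![false, true, false, true] then 0 else 1

/-- `wtH` at `ζ(4)` is `4`. [folklore] -/
theorem wtH_ω4 : wtH ω4 = 4 := by decide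
/-- `wtF` at `ζ(4)` is `1`. [folklore] -/
theorem wtF_ω4 : wtF ω4 = 1 := by decide
/-- `wtH` kills the Hoffman word `0101`. [folklore] -/
theorem wtH_bword_two_two : wtH (bword 4 [2, 2]) = 0 := by decide
/-- `wtF` kills the Hoffman word `0101`. [folklore] -/
theorem wtF_bword_two_two : wtF (bword 4 [2, 2]) = 0 := by decide
/-- `wtH` is duality-invariant on admissible words. [folklore] -/
theorem wtH_dual : ∀ ε : Fin 4 → Bool, Adm ε → wtH ε = wtH (dualWord ε) := by decide
/-- `wtF` is duality-invariant on admissible words. [folklore] -/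
theorem wtF_dual : ∀ ε : Fin 4 → Bool, Adm ε → wtF ε = wtF (dualWord ε) := by decide
/-- `wtH` kills the finite double shuffle vector of `(2),(2)` (`4·1 − 4 = 0`; kernel `decide`). [folklore] -/
theorem wtH_fds_two_two : ((fdsF [2] [2]).map fun p => p.2 * wtH (wordOf 4 p.1)).sum = 0 := by
  decide +kernel
/-- `wtF` kills Hoffman's relation vector of `s = (3)` (`1 − 1 − 0`). [folklore] -/
theorem wtF_hoffman_three : ((hoffmanF [3]).map fun p => p.2 * wtF (wordOf 4 p.1)).sum = 0 := by
  decide +kernel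
/-- `wtF` kills Hoffman's relation vector of `s = (2,1)` (`1 + 0 − 1`). [folklore] -/
theorem wtF_hoffman_two_one :
    ((hoffmanF [2, 1]).map fun p => p.2 * wtF (wordOf 4 p.1)).sum = 0 := by
  decide +kernel

/-- **Hoffman's relation is load-bearing in the line at weight `4`.** There is NO certificate for
the word `ω₀ω₀ω₀ω₁` (`ζ(4)`) of the shape `EdsCertificate 4` with the Hoffman-relation list `D`
empty: finite double shuffle (the single pair `(2),(2)`: `4 e₀₀₁₁ − e₀₀₀₁`), duality and the
Hoffman unit vector `e₀₁₀₁` are all killed by the functional `wtH`, which is `4` at `ζ(4)`.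
(Value level: FDS gives only `ζ(4) = 4 ζ(3,1)`; the ratio `ζ(4) : ζ(2,2)` needs Hoffman's
relation `ζ(4) = ζ(3,1) + ζ(2,2)` or Euler's evaluation.) [folklore] -/
theorem no_certificate_four_without_hoffmanRel :
    ¬ ∃ (H : List (List ℕ × ℚ)) (F : List ((List ℕ × List ℕ) × ℚ)) (K : List ((Fin 4 → Bool) × ℚ)),
      (∀ p ∈ H, MZV.IsHoffman p.1 ∧ MZV.weight p.1 = 4) ∧
      (∀ p ∈ F, MZV.IsAdmissible p.1.1 ∧ MZV.IsAdmissible p.1.2 ∧ p.1.1 ≠ [] ∧ p.1.2 ≠ [] ∧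
        MZV.weight p.1.1 + MZV.weight p.1.2 = 4) ∧
      (∀ p ∈ K, Adm p.1) ∧
      unitVec 4 ω4 - (H.map fun p => p.2 • unitVec 4 (bword 4 p.1)).sum =
        (F.map fun p => p.2 • fdsVec 4 p.1.1 p.1.2).sum + (K.map fun p => p.2 • dualVec 4 p.1).sum := by
  rintro ⟨H, F, K, hH, hF, hK, heq⟩
  have h := congrArg (func wtH) heq
  rw [map_sub, map_add, func_unitVec, wtH_ω4,
    func_sum_eq_zero wtH H (fun p => p.2) (fun p => unitVec 4 (bword 4 p.1)) ?_,
    func_sum_eq_zero wtH F (fun p => p.2) (fun p => fdsVec 4 p.1.1 p.1.2) ?_,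
    func_sum_eq_zero wtH K (fun p => p.2) (fun p => dualVec 4 p.1) ?_] at h
  · norm_num at h
  · intro p hp
    exact func_dualVec wtH p.1 (wtH_dual p.1 (hK p hp))
  · intro p hp
    obtain ⟨h1, h2, h3, h4, h5⟩ := hF p hp
    have hw1 : 2 ≤ MZV.weight p.1.1 := two_le_weight h1 h3
    have hw2 : 2 ≤ MZV.weight p.1.2 := two_le_weight h2 h4
    have e1 : p.1.1 = [2] := eq_two_of_isAdmissible h1 h3 (by omega)
    have e2 : p.1.2 = [2] := eq_two_of_isAdmissible h2 h4 (by omega)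
    show func wtH (fdsVec 4 p.1.1 p.1.2) = 0
    rw [e1, e2, func_fdsVec, wtH_fds_two_two]
  · intro p hp
    obtain ⟨hu, hw⟩ := hH p hp
    show func wtH (unitVec 4 (bword 4 p.1)) = 0
    rw [func_unitVec, eq_two_two_of_isHoffman hu hw, wtH_bword_two_two]

/-- **Finite double shuffle is load-bearing in the line at weight `4`.** There is NO certificate
for `ζ(4)` of the shape `EdsCertificate 4` with the FDS list `F` empty: Hoffman's relations
(`s = (3)`: `e₀₀₀₁ − e₀₀₁₁ − e₀₁₀₁`; `s = (2,1)`: `e₀₀₁₁ + e₀₁₀₁ − e₀₁₁₁`), duality and the Hoffman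
unit vector are killed by the indicator `wtF` of `ε ≠ 0101`, which is `1` at `ζ(4)`. [folklore] -/
theorem no_certificate_four_without_fds :
    ¬ ∃ (H : List (List ℕ × ℚ)) (D : List (List ℕ × ℚ)) (K : List ((Fin 4 → Bool) × ℚ)),
      (∀ p ∈ H, MZV.IsHoffman p.1 ∧ MZV.weight p.1 = 4) ∧
      (∀ p ∈ D, MZV.IsAdmissible p.1 ∧ MZV.weight p.1 + 1 = 4) ∧
      (∀ p ∈ K, Adm p.1) ∧
      unitVec 4 ω4 - (H.map fun p => p.2 • unitVec 4 (bword 4 p.1)).sum =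
        (D.map fun p => p.2 • hoffmanVec 4 p.1).sum + (K.map fun p => p.2 • dualVec 4 p.1).sum := by
  rintro ⟨H, D, K, hH, hD, hK, heq⟩
  have h := congrArg (func wtF) heq
  rw [map_sub, map_add, func_unitVec, wtF_ω4,
    func_sum_eq_zero wtF H (fun p => p.2) (fun p => unitVec 4 (bword 4 p.1)) ?_,
    func_sum_eq_zero wtF D (fun p => p.2) (fun p => hoffmanVec 4 p.1) ?_,
    func_sum_eq_zero wtF K (fun p => p.2) (fun p => dualVec 4 p.1) ?_] at h
  · norm_num at h
  · intro p hp
    exact func_dualVec wtF p.1 (wtF_dual p.1 (hK p hp))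
  · intro p hp
    obtain ⟨h1, h2⟩ := hD p hp
    show func wtF (hoffmanVec 4 p.1) = 0
    rcases eq_of_isAdmissible_weight_three h1 (by omega) with e | e
    · rw [e, func_hoffmanVec, wtF_hoffman_three]
    · rw [e, func_hoffmanVec, wtF_hoffman_two_one]
  · intro p hp
    obtain ⟨hu, hw⟩ := hH p hp
    show func wtF (unitVec 4 (bword 4 p.1)) = 0
    rw [func_unitVec, eq_two_two_of_isHoffman hu hw, wtF_bword_two_two]


end Summit.KontsevichZagierPeriods.Cruxes.HoffmanSpanInKZ.Disproof
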